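import Mathlib
import Literature.NumberTheory.LFunctions.Zhang2022.TypedSection16B
import Literature.NumberTheory.LFunctions.Zhang2022.Section16ACalM2Analytic
import Literature.NumberTheory.LFunctions.Zhang2022.AppendixALemma161Typed
import Literature.NumberTheory.LFunctions.Zhang2022.Section16Eq169Mellin
import Literature.NumberTheory.Sieve.DivisorBound
import HarnessLib

/-!
# Zhang (2022) §16 p. 94, the smoothed sum after Lemma 16.2: node `Z22:§16.u040`, second equality
# (`Typed.Section16B.Step16_u040b`) — DISCHARGED, with the summability of `Σ_n ϖ₂ⱼ(n)(ν∗χ)(n)n^{−s}`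

Topic `Literature/NumberTheory/LFunctions/Zhang2022` (Landau–Siegel audit tree; verdict-neutral).
Y. Zhang, *Discrete mean estimates and the Landau–Siegel zero*, arXiv:2211.02515v1 (2022)
[Zhang2022LandauSiegel] — **an unrefereed manuscript under adjudication** (ZHANG-L discharge lane).
§16 p. 94, tex L4656–L4661 (DAG `Z22:§16.u040`):

> We have `Σ_{n<T} ϖ₂ⱼ(n)(ν∗χ)(n)/n = Σ_n ϖ₂ⱼ(n)(ν∗χ)(n)n⁻¹g(T/n) + O(1/𝓛¹⁰)
>  = (1/2πi)∫_{(1)} ζ(1+s)³L(1+s,χ)³𝔲₂ⱼ(1+s) T^sω₁(s)/s ds + O(1/𝓛¹⁰)`.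

The second equality is typed as `Typed.Section16B.Step16_u040b` (a sub-leaf of the repaired §16
edge `eq16_16R2_of_subleaves`, leaf `h16_16` of the v19/v20 skeleton). This theorem-only file proves it
— in fact as an EXACT identity: on the line `Re s = 1` the integrand is the absolutely convergent
Dirichlet series `Σ_n ϖ₂ⱼ(ν∗χ)(n)n^{−(1+s)}` times `T^sω₁(s)/s` (tree
`Typed.Section16B.integrand16_u040_eq_series`; no continuation of `𝔲₂ⱼ` is involved), and the tree's
`GaussWeight.integral_LSeries_mul_kernel` (§4: `(2πi)⁻¹∫_{(c)}(Σ aₙn^{−s−w})X^wω₁(w)dw/w = Σ aₙn^{−s}g(X/n)`)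
at `X = T`, `c = 1`, `s = 0` is the display (the printed `O(1/𝓛¹⁰)` is inherited from the first
equality, u040a, and is not needed here; the constant `C = 0` is admissible and is the one filed).

The one analytic input is the absolute convergence at `σ = 2`, i.e. a polynomial bound for the
coefficients, which the manuscript leaves implicit:

* `norm_nuConvChi_le` — `|(ν∗χ)(n)| ≤ τ(n)²` (`(ν∗χ)(n) = Σ_{m∣n} χ(m)τ(m)`, tree
  `Typed.Section16B.nuConvChi_eq_sum_divisors`);
* `norm_varpi2_le` — `|ϖ₂ⱼ(n)| ≤ (K/c₀)·τ(n)¹³` whenever `|𝓜₂*(s)| ≥ c₀` on `|s−1| < 5α` and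
  `|β_j| < 5α` (`ϖ₂ⱼ(n) = Σ_{n=dl} λ₂(d)d^{β_j}χ(l)𝓜₂(d,l;1−β_j)/𝓜₂*(1−β_j)`, §16 p. 93; inputs:
  `|λ₂(d)| ≤ τ(d)²` (`Typed.Section16A.norm_lam2_one_le`), `|𝓜₂(d,l;s)| ≤ K∏_{q∣dl}(1+900q^{−9/10})`
  on `σ > 9/10` (`Typed.Section16A.norm_calM2_le`, u022), `∏_{q∣n}(1+900q^{−9/10}) ≤ 1024^{ω(n)} ≤ τ(n)¹⁰`);
* `lseriesSummable_varpi2_nuConvChi` — hence `Σ_n |ϖ₂ⱼ(ν∗χ)(n)|/n² < ∞` (divisor bound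
  `τ(n) ≤ Cn^{1/30}`, [cite: HardyWright2008, Theorem 315], tree `Sieve.exists_card_divisors_le_mul_rpow`);
* `integrand16_u040_eq_LSeries_mul_kernel`, `tsum_smoothed_eq_integral16_u040` — the exact identity;
* `step16_u040b_holds : Typed.Section16B.Step16_u040b c'` for every `c′` — **the u040b sub-leaf
  DISCHARGED** (`C = 0`; `D` large so that `|𝓜₂*| ≥ c₀` near `1` — tree
  `Typed.Section16B.inline16_calM2starLarge_of_lemma161` with `AppendixA.lemma161_holds` — and
  `|β_j| < 5α`, `Typed.Section16B.norm_betaJ_lt_five_alpha`; Assumption (A) enters only through the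
  former).

No new definitions, no named facts, no `sorry`. Nothing here bears on the first equality (u040a:
Gaussian unsmoothing, a separate sub-leaf), on the contour shift u041aR, on Theorems 1–2 of the
source, or on Landau–Siegel zeros.

## References

* Y. Zhang, arXiv:2211.02515v1 (2022), §16 pp. 93–94, tex L4597–L4599 (`ϖ₂ⱼ`), L4656–L4661 (u040);
  §4 (4.1) p. 19. [cite: Zhang2022LandauSiegel, §16 p.94 (u040)]
* G. H. Hardy, E. M. Wright, *An Introduction to the Theory of Numbers* (6th ed., 2008), Theorem 315
  (the divisor bound). [cite: HardyWright2008, Theorem 315]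
-/

noncomputable section

open Complex Real MeasureTheory Filter Topology
open Literature.NumberTheory.LFunctions.Zhang2022
open Literature.NumberTheory.LFunctions.Zhang2022.Skeleton
open Literature.NumberTheory.LFunctions.Zhang2022.Typed.Section16A

namespace Literature.NumberTheory.LFunctions.Zhang2022.Typed.Section16B

/-! ## §1. Divisor-function majorants -/

section Majorants

variable (c' : ℝ) {D : ℕ} [NeZero D] (χ : DirichletCharacter ℂ D)

/-- `2^{ω(n)} ≤ τ(n)` (`n ≥ 1`): `τ(n) = ∏_{p∣n}(v_p(n)+1)` with every factor `≥ 2`. [folklore] -/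
private theorem two_pow_card_primeFactors_le {n : ℕ} (hn : n ≠ 0) :
    2 ^ n.primeFactors.card ≤ n.divisors.card := by
  rw [Nat.card_divisors hn]
  refine Finset.pow_card_le_prod _ _ _ fun p hp => ?_
  have : 0 < n.factorization p := Nat.Prime.factorization_pos_of_dvd (Nat.prime_of_mem_primeFactors hp)
    hn (Nat.dvd_of_mem_primeFactors hp)
  omega

/-- `τ(k) ≤ τ(n)` for `k ∣ n`, `n ≥ 1`. [folklore] -/
private theorem card_divisors_le_of_dvd' {k n : ℕ} (hn : n ≠ 0) (hk : k ∣ n) :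
    k.divisors.card ≤ n.divisors.card :=
  Finset.card_le_card (Nat.divisors_subset_of_dvd hn hk)

/-- **The u022 weight is divisor-bounded**: `∏_{q∣n}(1 + 900q^{−9/10}) ≤ τ(n)¹⁰` for `n ≥ 1`
(each factor is `≤ 901 ≤ 2¹⁰`, and `2^{ω(n)} ≤ τ(n)`). [cite: Zhang2022LandauSiegel, §16 p.91 (u022)] -/
theorem prod_primeFactors_weight_le {n : ℕ} (hn : n ≠ 0) :
    ∏ q ∈ n.primeFactors, (1 + 900 / (q : ℝ) ^ (9 / 10 : ℝ)) ≤ (n.divisors.card : ℝ) ^ 10 := by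
  have hfac : ∀ q ∈ n.primeFactors, 1 + 900 / (q : ℝ) ^ (9 / 10 : ℝ) ≤ (2 : ℝ) ^ 10 := by
    intro q hq
    have hq2 : (2 : ℝ) ≤ q := by exact_mod_cast (Nat.prime_of_mem_primeFactors hq).two_le
    have hq1 : (1 : ℝ) ≤ (q : ℝ) ^ (9 / 10 : ℝ) := Real.one_le_rpow (by linarith) (by norm_num)
    have h900 : 900 / (q : ℝ) ^ (9 / 10 : ℝ) ≤ 900 := by
      rw [div_le_iff₀ (by linarith)]
      nlinarith
    linarith
  calc ∏ q ∈ n.primeFactors, (1 + 900 / (q : ℝ) ^ (9 / 10 : ℝ))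
      ≤ ∏ _q ∈ n.primeFactors, (2 : ℝ) ^ 10 :=
        Finset.prod_le_prod (fun q _ => by positivity) hfac
    _ = ((2 : ℝ) ^ n.primeFactors.card) ^ 10 := by rw [Finset.prod_const, ← pow_mul, mul_comm, pow_mul]
    _ ≤ (n.divisors.card : ℝ) ^ 10 := by
        gcongr
        exact_mod_cast two_pow_card_primeFactors_le hn

/-- **`|(ν∗χ)(n)| ≤ τ(n)²`** (`(ν∗χ)(n) = Σ_{m∣n} χ(m)τ(m)`, `|χ| ≤ 1`, `τ(m) ≤ τ(n)` for `m ∣ n`).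
[cite: Zhang2022LandauSiegel, §16 (16.15) p.94] -/
theorem norm_nuConvChi_le (n : ℕ) : ‖nuConvChi χ n‖ ≤ (n.divisors.card : ℝ) ^ 2 := by
  rcases Nat.eq_zero_or_pos n with rfl | hn
  · simp [nuConvChi]
  rw [nuConvChi_eq_sum_divisors χ hn]
  calc ‖∑ m ∈ n.divisors, χ (m : ZMod D) * (m.divisors.card : ℂ)‖
      ≤ ∑ m ∈ n.divisors, ‖χ (m : ZMod D) * (m.divisors.card : ℂ)‖ := norm_sum_le _ _
    _ ≤ ∑ _m ∈ n.divisors, (n.divisors.card : ℝ) := Finset.sum_le_sum fun m hm => by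
        rw [norm_mul, Complex.norm_natCast]
        calc ‖χ (m : ZMod D)‖ * (m.divisors.card : ℝ) ≤ 1 * (m.divisors.card : ℝ) :=
              mul_le_mul_of_nonneg_right (DirichletCharacter.norm_le_one χ _) (Nat.cast_nonneg _)
          _ ≤ (n.divisors.card : ℝ) := by
              rw [one_mul]
              exact_mod_cast card_divisors_le_of_dvd' hn.ne' (Nat.dvd_of_mem_divisors hm)
    _ = (n.divisors.card : ℝ) ^ 2 := by rw [Finset.sum_const, nsmul_eq_mul, sq]

omit [NeZero D] in
/-- `Re β_j = 0` (every `β_j` is `i·b_j`). [cite: Zhang2022LandauSiegel, §2 (2.13)] -/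
private theorem betaJ_re (j : ℕ) : (betaJ c' D j).re = 0 := by
  unfold betaJ
  split_ifs <;>
    simp [beta1_eq_b1_mul_I, beta2_eq_b2_mul_I, beta3_eq_b3_mul_I]

/-- **`|ϖ₂ⱼ(n)| ≤ (K/c₀)·τ(n)¹³`**, provided `|𝓜₂*(s)| ≥ c₀ > 0` on the disc `|s − 1| < 5α` (Lemma 16.1,
"`|𝓜₂*(s)| ≫ 1`") and `|β_j| < 5α`; here `K = exp(225Σ'_q q^{−19/10})` is the constant of u022
(`norm_calM2_le`): each of the `τ(n)` terms of `ϖ₂ⱼ(n) = Σ_{n=dl}λ₂(d)d^{β_j}χ(l)𝓜₂(d,l;1−β_j)/𝓜₂*(1−β_j)`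
is at most `τ(n)²·1·1·Kτ(n)¹⁰/c₀`. [cite: Zhang2022LandauSiegel, §16 p.93 (u030)] -/
theorem norm_varpi2_le {c₀ : ℝ} (hc₀ : 0 < c₀)
    (hM : ∀ s : ℂ, ‖s - 1‖ < 5 * alpha D → c₀ ≤ ‖calM2star c' χ s‖) {j : ℕ}
    (hβ : ‖betaJ c' D j‖ < 5 * alpha D) (n : ℕ) :
    ‖varpi2 c' χ j n‖ ≤
      Real.exp (225 * ∑' q : Nat.Primes, ((q : ℕ) : ℝ) ^ (-(19 / 10 : ℝ))) / c₀ *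
        (n.divisors.card : ℝ) ^ 13 := by
  set K : ℝ := Real.exp (225 * ∑' q : Nat.Primes, ((q : ℕ) : ℝ) ^ (-(19 / 10 : ℝ))) with hK
  have hK0 : 0 ≤ K := (Real.exp_pos _).le
  rcases Nat.eq_zero_or_pos n with rfl | hn
  · simp [varpi2]
  have hs : ‖(1 - betaJ c' D j) - 1‖ < 5 * alpha D := by rwa [sub_sub_cancel_left, norm_neg]
  have hMs : c₀ ≤ ‖calM2star c' χ (1 - betaJ c' D j)‖ := hM _ hs
  have hre : 9 / 10 < (1 - betaJ c' D j).re := by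
    rw [Complex.sub_re, Complex.one_re, betaJ_re]; norm_num
  -- termwise bound
  have hterm : ∀ x ∈ n.divisorsAntidiagonal,
      ‖lam2 c' χ x.1 1 * (x.1 : ℂ) ^ betaJ c' D j * χ (x.2 : ZMod D) *
          calM2 c' χ x.1 x.2 (1 - betaJ c' D j) / calM2star c' χ (1 - betaJ c' D j)‖ ≤
        (n.divisors.card : ℝ) ^ 2 * (K * (n.divisors.card : ℝ) ^ 10) / c₀ := by
    intro x hx
    obtain ⟨hprod, hn0⟩ := Nat.mem_divisorsAntidiagonal.mp hx
    have hx1 : 0 < x.1 := Nat.pos_of_ne_zero fun h => hn0 (by rw [← hprod, h, zero_mul])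
    have hx2 : 0 < x.2 := Nat.pos_of_ne_zero fun h => hn0 (by rw [← hprod, h, mul_zero])
    have h1 : ‖lam2 c' χ x.1 1‖ ≤ (n.divisors.card : ℝ) ^ 2 :=
      (norm_lam2_one_le c' χ hx1.ne').trans (pow_le_pow_left₀ (Nat.cast_nonneg _)
        (by exact_mod_cast card_divisors_le_of_dvd' hn0 ⟨x.2, hprod.symm⟩) 2)
    have h2 : ‖(x.1 : ℂ) ^ betaJ c' D j‖ = 1 := by
      rw [Complex.norm_natCast_cpow_of_pos hx1, betaJ_re, Real.rpow_zero]
    have h3 : ‖χ (x.2 : ZMod D)‖ ≤ 1 := DirichletCharacter.norm_le_one χ _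
    have h4 : ‖calM2 c' χ x.1 x.2 (1 - betaJ c' D j)‖ ≤ K * (n.divisors.card : ℝ) ^ 10 := by
      refine (norm_calM2_le c' χ hx1 hx2 hre).trans ?_
      rw [hprod]
      exact mul_le_mul_of_nonneg_left (prod_primeFactors_weight_le hn0) hK0
    rw [norm_div, norm_mul, norm_mul, norm_mul, h2, mul_one]
    have hnum : ‖lam2 c' χ x.1 1‖ * ‖χ (x.2 : ZMod D)‖ * ‖calM2 c' χ x.1 x.2 (1 - betaJ c' D j)‖ ≤
        (n.divisors.card : ℝ) ^ 2 * (K * (n.divisors.card : ℝ) ^ 10) := by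
      calc ‖lam2 c' χ x.1 1‖ * ‖χ (x.2 : ZMod D)‖ * ‖calM2 c' χ x.1 x.2 (1 - betaJ c' D j)‖
          ≤ (n.divisors.card : ℝ) ^ 2 * 1 * (K * (n.divisors.card : ℝ) ^ 10) :=
            mul_le_mul (mul_le_mul h1 h3 (norm_nonneg _) (by positivity)) h4 (norm_nonneg _)
              (by positivity)
        _ = (n.divisors.card : ℝ) ^ 2 * (K * (n.divisors.card : ℝ) ^ 10) := by ring
    calc ‖lam2 c' χ x.1 1‖ * ‖χ (x.2 : ZMod D)‖ * ‖calM2 c' χ x.1 x.2 (1 - betaJ c' D j)‖ /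
          ‖calM2star c' χ (1 - betaJ c' D j)‖
        ≤ ‖lam2 c' χ x.1 1‖ * ‖χ (x.2 : ZMod D)‖ * ‖calM2 c' χ x.1 x.2 (1 - betaJ c' D j)‖ / c₀ :=
          div_le_div_of_nonneg_left (by positivity) hc₀ hMs
      _ ≤ (n.divisors.card : ℝ) ^ 2 * (K * (n.divisors.card : ℝ) ^ 10) / c₀ :=
          div_le_div_of_nonneg_right hnum hc₀.le
  unfold varpi2
  calc ‖∑ x ∈ n.divisorsAntidiagonal, lam2 c' χ x.1 1 * (x.1 : ℂ) ^ betaJ c' D j * χ (x.2 : ZMod D) *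
          calM2 c' χ x.1 x.2 (1 - betaJ c' D j) / calM2star c' χ (1 - betaJ c' D j)‖
      ≤ ∑ x ∈ n.divisorsAntidiagonal, ‖lam2 c' χ x.1 1 * (x.1 : ℂ) ^ betaJ c' D j * χ (x.2 : ZMod D) *
          calM2 c' χ x.1 x.2 (1 - betaJ c' D j) / calM2star c' χ (1 - betaJ c' D j)‖ := norm_sum_le _ _
    _ ≤ ∑ _x ∈ n.divisorsAntidiagonal, (n.divisors.card : ℝ) ^ 2 * (K * (n.divisors.card : ℝ) ^ 10) / c₀ :=
        Finset.sum_le_sum hterm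
    _ = (n.divisors.card : ℝ) * ((n.divisors.card : ℝ) ^ 2 * (K * (n.divisors.card : ℝ) ^ 10) / c₀) := by
        rw [Finset.sum_const, nsmul_eq_mul, ← Nat.map_div_right_divisors, Finset.card_map]
    _ = K / c₀ * (n.divisors.card : ℝ) ^ 13 := by ring

/-- **Absolute convergence of `Σ_n ϖ₂ⱼ(n)(ν∗χ)(n)n^{−s}` at `σ = 2`**, in the form used on the line
`Re s = 1` of (16.u040): the coefficients `aₙ = ϖ₂ⱼ(n)(ν∗χ)(n)/n` satisfy `Σ_n |aₙ|/n < ∞`, since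
`|ϖ₂ⱼ(ν∗χ)(n)| ≤ (K/c₀)τ(n)¹⁵ ≤ C′n^{1/2}` (divisor bound). [cite: Zhang2022LandauSiegel, §16 p.94] -/
theorem lseriesSummable_varpi2_nuConvChi {c₀ : ℝ} (hc₀ : 0 < c₀)
    (hM : ∀ s : ℂ, ‖s - 1‖ < 5 * alpha D → c₀ ≤ ‖calM2star c' χ s‖) {j : ℕ}
    (hβ : ‖betaJ c' D j‖ < 5 * alpha D) :
    LSeriesSummable (fun n => varpi2 c' χ j n * nuConvChi χ n / n) 1 := by
  set K : ℝ := Real.exp (225 * ∑' q : Nat.Primes, ((q : ℕ) : ℝ) ^ (-(19 / 10 : ℝ))) with hK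
  have hK0 : 0 ≤ K := (Real.exp_pos _).le
  obtain ⟨C, hC1, hC⟩ :=
    Literature.NumberTheory.Sieve.exists_card_divisors_le_mul_rpow (by norm_num : (0 : ℝ) < 1 / 30)
  have hC0 : 0 ≤ C := zero_le_one.trans hC1
  -- majorant `(K/c₀)·C¹⁵·n^{−3/2}`
  have hmaj : Summable fun n : ℕ => K / c₀ * C ^ 15 * (n : ℝ) ^ (-(3 / 2 : ℝ)) :=
    (Real.summable_nat_rpow.mpr (by norm_num)).mul_left _
  refine Summable.of_norm_bounded hmaj fun n => ?_
  rcases eq_or_ne n 0 with rfl | hn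
  · simp only [LSeries.term_zero, norm_zero, Nat.cast_zero]
    exact mul_nonneg (mul_nonneg (div_nonneg hK0 hc₀.le) (pow_nonneg hC0 _)) (Real.rpow_nonneg le_rfl _)
  have hn0 : 0 < n := Nat.pos_of_ne_zero hn
  have hnR : (0 : ℝ) < n := by exact_mod_cast hn0
  have hτ : (n.divisors.card : ℝ) ≤ C * (n : ℝ) ^ (1 / 30 : ℝ) := hC n hn
  have hτ15 : (n.divisors.card : ℝ) ^ 15 ≤ C ^ 15 * (n : ℝ) ^ (1 / 2 : ℝ) := by
    calc (n.divisors.card : ℝ) ^ 15 ≤ (C * (n : ℝ) ^ (1 / 30 : ℝ)) ^ 15 :=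
          pow_le_pow_left₀ (Nat.cast_nonneg _) hτ 15
      _ = C ^ 15 * (n : ℝ) ^ (1 / 2 : ℝ) := by
          rw [mul_pow, ← Real.rpow_natCast ((n : ℝ) ^ (1 / 30 : ℝ)) 15, ← Real.rpow_mul hnR.le]
          norm_num
  have hcoef : ‖varpi2 c' χ j n * nuConvChi χ n‖ ≤ K / c₀ * (n.divisors.card : ℝ) ^ 15 := by
    rw [norm_mul]
    calc ‖varpi2 c' χ j n‖ * ‖nuConvChi χ n‖
        ≤ (K / c₀ * (n.divisors.card : ℝ) ^ 13) * (n.divisors.card : ℝ) ^ 2 :=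
          mul_le_mul (norm_varpi2_le c' χ hc₀ hM hβ n) (norm_nuConvChi_le χ n) (norm_nonneg _)
            (by positivity)
      _ = K / c₀ * (n.divisors.card : ℝ) ^ 15 := by ring
  -- the term
  simp only [LSeries.term_of_ne_zero hn, norm_div, Complex.norm_natCast, Complex.cpow_one]
  rw [div_div, div_le_iff₀ (by positivity)]
  calc ‖varpi2 c' χ j n * nuConvChi χ n‖ ≤ K / c₀ * (n.divisors.card : ℝ) ^ 15 := hcoef
    _ ≤ K / c₀ * (C ^ 15 * (n : ℝ) ^ (1 / 2 : ℝ)) :=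
        mul_le_mul_of_nonneg_left hτ15 (div_nonneg hK0 hc₀.le)
    _ = K / c₀ * C ^ 15 * (n : ℝ) ^ (-(3 / 2 : ℝ)) * ((n : ℝ) * n) := by
        rw [show (n : ℝ) * n = (n : ℝ) ^ (2 : ℝ) by rw [Real.rpow_two, sq], mul_assoc, mul_assoc,
          ← Real.rpow_add hnR]
        norm_num

end Majorants

/-! ## §2. The exact `ω₁`-Mellin identity of (16.u040) -/

section Identity

variable (c' : ℝ) {D : ℕ} [NeZero D] (χ : DirichletCharacter ℂ D)

/-- On `Re s = 1` the u040 integrand is `(Σ_n aₙ n^{−(0+(1+iv))})·K_T(v)` with `aₙ = ϖ₂ⱼ(ν∗χ)(n)/n` and the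
§4 kernel `K_X(v) = X^{1+iv}ω₁(1+iv)/(1+iv)` (`GaussWeight.kernel`) — the tree's
`integrand16_u040_eq_series` rewritten. [cite: Zhang2022LandauSiegel, §16 p.94 (u040)] -/
theorem integrand16_u040_eq_LSeries_mul_kernel (j : ℕ) (v : ℝ) :
    integrand16_u040 c' χ j (1 + v * I) =
      LSeries (fun n => varpi2 c' χ j n * nuConvChi χ n / n) (0 + ((1 : ℝ) + v * I)) *
        GaussWeight.kernel (ell D ^ 30) 1 (bigT D) v := by
  have hs0 : (1 : ℂ) + (1 + v * I) ≠ 0 := by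
    intro h
    have := congrArg Complex.re h
    simp at this
  have hser : (∑' n : ℕ, varpi2 c' χ j n * nuConvChi χ n / (n : ℂ) ^ (1 + (1 + v * I))) =
      LSeries (fun n => varpi2 c' χ j n * nuConvChi χ n / n) (1 + v * I) := by
    rw [LSeries]
    refine tsum_congr fun n => ?_
    rcases eq_or_ne n 0 with rfl | hn
    · rw [LSeries.term_zero, Nat.cast_zero, Complex.zero_cpow hs0, div_zero]
    · simp only [LSeries.term_of_ne_zero hn]
      rw [Complex.cpow_add _ _ (Nat.cast_ne_zero.mpr hn), Complex.cpow_one, div_div]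
  rw [integrand16_u040_eq_series, hser, GaussWeight.kernel]
  push_cast
  rw [zero_add]
  ring

/-- **The second equality of the u040 display, exactly**: for `𝓛 > 0`, if `Σ_n |ϖ₂ⱼ(ν∗χ)(n)|/n² < ∞`
then `(1/2π)∫_ℝ [integrand16_u040](1+iv) dv = Σ_n ϖ₂ⱼ(n)(ν∗χ)(n)n⁻¹g(T/n)` (`g = Skeleton.gW`, (4.1)) —
`GaussWeight.integral_LSeries_mul_kernel` at `X = T`, `c = 1`, `s = 0`.
[cite: Zhang2022LandauSiegel, §16 p.94 (u040); §4 (4.1) p.19] -/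
theorem tsum_smoothed_eq_integral16_u040 (hℓ : 0 < ell D) (j : ℕ)
    (hsum : LSeriesSummable (fun n => varpi2 c' χ j n * nuConvChi χ n / n) 1) :
    (1 / (2 * π) : ℂ) * ∫ v : ℝ, integrand16_u040 c' χ j (1 + v * I) =
      ∑' n : ℕ, varpi2 c' χ j n * nuConvChi χ n / (n : ℂ) * (gW D (bigT D / n) : ℂ) := by
  have hΛ : 0 < ell D ^ 30 := pow_pos hℓ 30
  have hT : 0 < bigT D := Real.exp_pos _
  have hsum' : LSeriesSummable (fun n => varpi2 c' χ j n * nuConvChi χ n / n) (0 + ((1 : ℝ) : ℂ)) := by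
    rw [zero_add, Complex.ofReal_one]; exact hsum
  have hker := GaussWeight.integral_LSeries_mul_kernel hΛ one_pos hT hsum'
  simp_rw [integrand16_u040_eq_LSeries_mul_kernel c' χ j]
  rw [hker]
  refine tsum_congr fun n => ?_
  rcases eq_or_ne n 0 with rfl | hn
  · simp [LSeries.term_zero]
  · simp only [LSeries.term_of_ne_zero hn, Complex.cpow_zero, div_one, gW]

end Identity

/-! ## §3. `Step16_u040b` -/

section U040b

/-- For `D ≥ ⌈exp L⌉`, `𝓛 = log D ≥ L`. [folklore] -/
private theorem le_ell_of_ceil_exp_le' {L : ℝ} {D : ℕ} (hD : ⌈Real.exp L⌉₊ ≤ D) : L ≤ ell D := by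
  have h1 : Real.exp L ≤ D := le_trans (Nat.le_ceil _) (by exact_mod_cast hD)
  have hD0 : (0 : ℝ) < D := lt_of_lt_of_le (Real.exp_pos L) h1
  rw [ell, Real.le_log_iff_exp_le hD0]
  exact h1

/-- **`Z22:§16.u040`, second equality — the sub-leaf `Typed.Section16B.Step16_u040b c′` HOLDS for every
`c′`** (with `C = 0`: the identity is exact), for `D` large under (A): `|𝓜₂*| ≥ c₀` near `1`
(Lemma 16.1 ⇒ `Inline16_calM2starLarge`, tree) and `|β_j| < 5α` (`j = 1, 2`) give the absolute
convergence `lseriesSummable_varpi2_nuConvChi`, and `tsum_smoothed_eq_integral16_u040` is the display.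
[cite: Zhang2022LandauSiegel, §16 p.94 (u040)] -/
theorem step16_u040b_holds (c' : ℝ) : Step16_u040b c' := by
  obtain ⟨c₀, hc₀, D₀, hM⟩ := inline16_calM2starLarge_of_lemma161 c' (AppendixA.lemma161_holds c')
  refine ⟨0, max D₀ ⌈Real.exp (max 2 (Real.pi * (5 * |c'| + 1)))⌉₊, fun D _ χ hD hq hp hA j hj => ?_⟩
  have hD₀ : D₀ ≤ D := le_trans (le_max_left _ _) hD
  have hL := le_ell_of_ceil_exp_le' (le_trans (le_max_right _ _) hD)
  have hℓ2 : 2 ≤ ell D := le_trans (le_max_left _ _) hL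
  have hℓπ : Real.pi * (5 * |c'| + 1) ≤ ell D := le_trans (le_max_right _ _) hL
  have hℓ0 : 0 < ell D := by linarith
  have hβ : ‖betaJ c' D j‖ < 5 * alpha D := norm_betaJ_lt_five_alpha hℓ2 hℓπ hj
  have hsum := lseriesSummable_varpi2_nuConvChi c' χ hc₀ (hM D χ hD₀ hq hp hA) hβ
  rw [← tsum_smoothed_eq_integral16_u040 c' χ hℓ0 j hsum, sub_self, norm_zero, zero_mul]

variable (c' : ℝ) in
/-- `Step16_u040b` — `_holds` alias of `step16_u040b_holds` above under the fact's exact name, stated under the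
prover's own binders as section variables (appended 2026-08-28, D-0026 bookkeeping: the proof term is the
existing theorem of this file; no statement, definition or attribute is edited; no new named fact; the
ledger's debt table listed the fact unproved). [cite: Zhang2022LandauSiegel, §16 p.94 (u040)] -/
theorem _root_.Literature.NumberTheory.LFunctions.Zhang2022.Typed.Section16B.Step16_u040b_holds :
    _root_.Literature.NumberTheory.LFunctions.Zhang2022.Typed.Section16B.Step16_u040b c' :=
  _root_.Literature.NumberTheory.LFunctions.Zhang2022.Typed.Section16B.step16_u040b_holds (c' := c')

end U040b

end Literature.NumberTheory.LFunctions.Zhang2022.Typed.Section16B
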